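import Summits.CriticalPhenomena.PercolationContinuityZ3.Theorems.PercNearOneGluingNoHeavyQuantFarTreeRowSplit
import Summits.CriticalPhenomena.PercolationContinuityZ3.Theorems.PercNearOneGluingNoHeavyQuantHeavyNodeByNameViaFree
import Summits.CriticalPhenomena.PercolationContinuityZ3.Theorems.PercNearOneGluingNoHeavyQuantTreeRowReflect
import Summits.CriticalPhenomena.PercolationContinuityZ3.Theorems.PercNearOneGluingNoHeavyQuantTreeRowFloorMarkov
import HarnessLib

/-!
# QUANT lane R8 after the heavy node landed BY NAME: `Quant.FarTreeRow` ⟸ the LIGHT law-level rows alone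
# (`LawDec.TreeBuiltFARLight`, the residual named; the reduction is UNCONDITIONAL)

builds on p205010 (kernel theorem, internal audit signed; external expert review pending)

Statement + support file (`--supports stmt-CriticalPhenomena-4575`), QUANT lane typer seat prim-quant-stmt (gen 38), rung R8 of
`run/shared/lean/prim/quant/LADDER.md` (GEN-41 addendum: heavy half closed by name); README V387; memo
`run/shared/lean/prim/quant/prim-quant-stmt-g38/BIGBLOCKS-G38.md`.  Typer brief item (c) — this file NAMES the residual obligation of the
lane's open row and records, by name, that every line still alive implies it; it is not a new route or node.

WHAT HAPPENED.  ✓ p390160 `…QuantHeavyNodeByNameViaFree` (arm-3 g168/g169, commit a7481d0e6c27) made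
`LawDec.tlbGateConvClosedHeavy_holds` and `Quant.farTreeRowHeavy_holds : FarTreeRowHeavy` theorems of the tree — the far-relay row on every
rooted weighted forest all of whose relay marginals exceed `1/2` (independent second certificate: ✓ p391208 `…QuantHeavyTLB`,
`LawDec.tlb_gate_lconv_of_heavy`).  Typer g35's floor split `Quant.farTreeRow_of_heavy_and_lightRows` (✓ p387963) derives `Quant.FarTreeRow`
from (heavy) the body of `FarTreeRowHeavy` and (light) the law-level far row for tree-built laws at floors `x < 1/2`.  With the heavy
hypothesis now DISCHARGED BY NAME:

* **`LawDec.TreeBuiltFARLight`** (`@[conjecture]`, the residual named): every tree-built count law `μ` on `{0..M}` at a floor `x < 1/2`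
  (`LawDec.TreeBuilt x M μ`) with `2j < mean` has `x ≤ μ{j+1..M}` — `LawDec.TreeBuiltFAR` restricted to light floors.
* **`Quant.farTreeRow_of_treeBuiltFARLight : TreeBuiltFARLight → FarTreeRow`** — UNCONDITIONAL (no heavy hypothesis left):
  the crux's R8 row is now literally its light law-level half.
* by name, every surviving line implies the light node: `treeBuiltFARLight_of_treeBuiltFAR`, `…_of_treeBuiltDEC`, `…_of_sdecConvClosed`
  (census-2 g53's T-DEC route), `…_of_treeBuiltRowFloor` (typer g36's floor-resolved threshold `(1+x)·j`), `…_of_treeBuiltReflectRow`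
  (typer g37's Conjecture R); and the proved fragment `treeBuiltFARLight_of_top_le_two_mul` (laws with `M ≤ 2j`, typer g37's Markov half,
  every floor — so the light node's content is the many-relay case `2j < M`, `treeBuiltFARLight_iff_many_relays`).

HONEST STATUS: `TreeBuiltFARLight` (hence `TreeBuiltFAR`, `Quant.FarTreeRow`) OPEN; its binding sub-statements of record are the all-depth
DEC closures `LawDec.SingleGateConvClosed ⟺ LawDec.SGCGiantStep` / `LawDec.GatedConvEmptyFree` (README V379/V384/V386); every finite or
flat description of the light class tried so far is refuted (PLANNER-BRIEF §33 add. 6/8).  The RATE class log\* and the honest sentence of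
`run/shared/lean/prim/quant/README.md` are unchanged.  [this work]; the gluing rows served [cite: KozmaNitzan2024, Conjecture 3 (p. 15)];
product measure [cite: Grimmett1999, §1.3 p. 10].
-/

noncomputable section

namespace Summit.CriticalPhenomena.PercolationContinuityZ3.Theorems

namespace Quant

open Finset

namespace LawDec

/-- **CONJECTURE (THE LIGHT HALF OF THE LAW-LEVEL FAR ROW; the residual of R8 named, typer g38).**  Every tree-built count law `μ`
on `{0..M}` at a LIGHT floor `x < 1/2` (`LawDec.TreeBuilt x M μ`) and every layer `j` with `2j < mean μ` satisfy `x ≤ μ{j+1, …, M}`.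
This is `LawDec.TreeBuiltFAR` restricted to `x < 1/2`; with the heavy node landed by name it ALONE implies `Quant.FarTreeRow`
(`Quant.farTreeRow_of_treeBuiltFARLight`).  Evidence: that of `Quant.FarTreeRow` / `LawDec.SingleGateConvClosed` (corner census
0 / 94 551, README V384; tree censuses CENSUS-GAIN §14).  builds on p205010 (kernel theorem, internal audit signed; external expert review
pending). [this work] [status: open] -/
@[conjecture] def TreeBuiltFARLight : Prop :=
  ∀ (x : ℝ) (M : ℕ) (μ : ℕ → ℝ), TreeBuilt x M μ → x < 1 / 2 → ∀ j : ℕ,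
    (2 * j : ℝ) < ∑ h ∈ Finset.range (M + 1), (h : ℝ) * μ h → x ≤ ∑ h ∈ Finset.Ico (j + 1) (M + 1), μ h

/-- `TreeBuiltFAR ⟹ TreeBuiltFARLight` (restriction to light floors). [this work] -/
theorem treeBuiltFARLight_of_treeBuiltFAR (h : TreeBuiltFAR) : TreeBuiltFARLight :=
  fun x M μ hμ _ j hj => h x M μ hμ j hj

/-- `TreeBuiltDEC ⟹ TreeBuiltFARLight` (through `TreeBuiltFAR`). [this work] -/
theorem treeBuiltFARLight_of_treeBuiltDEC (h : TreeBuiltDEC) : TreeBuiltFARLight :=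
  treeBuiltFARLight_of_treeBuiltFAR (treeBuiltFAR_of_treeBuiltDEC h)

/-- `SDECConvClosed ⟹ TreeBuiltFARLight` (census-2 g53's T-DEC route, through `TreeBuiltFAR`). [this work] -/
theorem treeBuiltFARLight_of_sdecConvClosed (h : SDECConvClosed) : TreeBuiltFARLight :=
  treeBuiltFARLight_of_treeBuiltFAR (treeBuiltFAR_of_sdecConvClosed h)

/-- `TreeBuiltRowFloor ⟹ TreeBuiltFARLight` (typer g36's floor-resolved threshold `(1 + x)·j ≤ 2j`). [this work] -/
theorem treeBuiltFARLight_of_treeBuiltRowFloor (h : TreeBuiltRowFloor) : TreeBuiltFARLight :=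
  treeBuiltFARLight_of_treeBuiltFAR (treeBuiltFAR_of_treeBuiltRowFloor h)

/-- `TreeBuiltReflectRow ⟹ TreeBuiltFARLight` (typer g37's Conjecture R, through `TreeBuiltRowFloor`). [this work] -/
theorem treeBuiltFARLight_of_treeBuiltReflectRow (h : TreeBuiltReflectRow) : TreeBuiltFARLight :=
  treeBuiltFARLight_of_treeBuiltRowFloor (treeBuiltRowFloor_of_treeBuiltReflectRow h)

/-- **The proved fragment (every floor): laws with at most `2j` relays** — for `M ≤ 2j` the (stronger, floor-resolved) row is typer
g37's Markov theorem `treeBuiltRowFloor_of_top_le_two_mul`; here in the `2j < mean` form of the light node. [this work] -/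
theorem treeBuiltFARLight_of_top_le_two_mul {x : ℝ} {M : ℕ} {μ : ℕ → ℝ} (hμ : TreeBuilt x M μ) (j : ℕ) (hM : M ≤ 2 * j)
    (hmean : (2 * j : ℝ) < ∑ h ∈ Finset.range (M + 1), (h : ℝ) * μ h) :
    x ≤ ∑ h ∈ Finset.Ico (j + 1) (M + 1), μ h := by
  have hx1 : x < 1 := (treeBuilt_lawFacts hμ).2.1
  have hj0 : (0 : ℝ) ≤ j := Nat.cast_nonneg j
  exact treeBuiltRowFloor_of_top_le_two_mul hμ j hM (lt_of_le_of_lt (by nlinarith) hmean)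

/-- **The light node is its many-relay case**: `TreeBuiltFARLight` is equivalent to its restriction to laws with `2j < M`
(the case `M ≤ 2j` being `treeBuiltFARLight_of_top_le_two_mul`). [this work] -/
theorem treeBuiltFARLight_iff_many_relays :
    TreeBuiltFARLight ↔
      ∀ (x : ℝ) (M : ℕ) (μ : ℕ → ℝ), TreeBuilt x M μ → x < 1 / 2 → ∀ j : ℕ, 2 * j < M →
        (2 * j : ℝ) < ∑ h ∈ Finset.range (M + 1), (h : ℝ) * μ h → x ≤ ∑ h ∈ Finset.Ico (j + 1) (M + 1), μ h := by
  constructor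
  · intro H x M μ hμ hx j _ hmean
    exact H x M μ hμ hx j hmean
  · intro H x M μ hμ hx j hmean
    by_cases hM : 2 * j < M
    · exact H x M μ hμ hx j hM hmean
    · exact treeBuiltFARLight_of_top_le_two_mul hμ j (not_lt.1 hM) hmean

end LawDec

/-- **`Quant.FarTreeRow` ⟸ THE LIGHT LAW-LEVEL ROWS ALONE — UNCONDITIONAL.**  Typer g35's floor split
`farTreeRow_of_heavy_and_lightRows` with its heavy hypothesis discharged by the tree theorem `Quant.farTreeRowHeavy_holds`
(✓ p390160, arm-3's `…QuantHeavyNodeByNameViaFree`).  After this file the crux's R8 row is, by name, exactly `LawDec.TreeBuiltFARLight`.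
[this work] -/
theorem farTreeRow_of_treeBuiltFARLight (hL : LawDec.TreeBuiltFARLight) : FarTreeRow :=
  farTreeRow_of_heavy_and_lightRows farTreeRowHeavy_holds (fun x M μ hμ hx j hj => hL x M μ hμ hx j hj)

/-- `Quant.FarTreeRow` from typer g36's floor-resolved conjecture restricted to NOTHING heavier than the light node's use of it
(recorded for the map: `TreeBuiltRowFloor → FarTreeRow` was `farTreeRow_of_treeBuiltRowFloor`; the light restriction suffices). [this work] -/
theorem farTreeRow_of_treeBuiltRowFloor_light
    (h : ∀ (x : ℝ) (M : ℕ) (μ : ℕ → ℝ), LawDec.TreeBuilt x M μ → x < 1 / 2 → ∀ j : ℕ,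
      (1 + x) * (j : ℝ) < ∑ k ∈ Finset.range (M + 1), (k : ℝ) * μ k → x ≤ ∑ k ∈ Finset.Ico (j + 1) (M + 1), μ k) :
    FarTreeRow := by
  refine farTreeRow_of_treeBuiltFARLight fun x M μ hμ hx j hmean => h x M μ hμ hx j ?_
  have hx1 : x < 1 := (LawDec.treeBuilt_lawFacts hμ).2.1
  have hj0 : (0 : ℝ) ≤ j := Nat.cast_nonneg j
  exact lt_of_le_of_lt (by nlinarith) hmean

end Quant

end Summit.CriticalPhenomena.PercolationContinuityZ3.Theorems
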